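import Summits.BirchSwinnertonDyer.BirchSwinnertonDyer.Theses.UniversalToricDescent
import HarnessLib

/-!
# NODE g18 — `zeta-integrality-core-split` (crux 24207 `RationalSplitIMCInclusionAtThree`, RATWALL)

Unit `cruxidea-stmt-BirchSwinnertonDyer-24207-1-g18` (planner, crux-ideate, gen 18, 2026-08-31). D-0171 node: a compiling
door whose kernel theorem concludes the crux BY NAME (§C), every piece tagged COSTUME / WEAKER / UNDECIDED with a kernel
certificate where possible (§A–§B), leaves tagged ATTACKABLE / INSTRUMENTABLE / IDEA-NEEDED / BARRIER (this docstring).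

## KEEP / KILL (g18) — the g17 table STANDS (no vet / instrument / director line on 24207 since g17 RESULT 09:27Z)
KEEP g0 eisenstein-kato-swap · base-doubling-tau-signs · g2 adic-congruence-ladder · g3 nonsplit-patching-saturation ·
g5 bounded-resolvent-twist-door · g6 root-trichotomy-rank-cap · g7 endoscopic-accumulating-reciprocity · g8 derived-antidiagonal-
content-bound · g9 frozen-channel-padic-pin · g10 torsion-anchored-reciprocity · g11 cubic-taming-descent · g12 layer-cake-
sublinear-slack · g13 untamed-cubic-host-gcd · g14 eisenstein-orbit-amplification · g15 psi-zero-honda-frame · g16 different-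
matched-layer-fitting · g17 yoshida-spectator-carrier.  KILLED stay killed: universal-toric-half-order, germ-recentred-
tempered-heegner, tempered-eisenstein, GU(2,1)-as-supply.  NEW g18: zeta-integrality-core-split (this node).

## The idea (technique class: Poitou–Tate determinant calculus + Kato local ε-isomorphism; NO special element, NO host, NO layer)
Notation: `Λ = ℤ₃⟦Γ⟧`, `𝕋 = T₃E ⊗ Λ(κ_ac⁻¹)`, `M := H¹(G_{K,S}, 𝕋)` (torsion-free of Λ-rank 2 on torsion rows: ρ̄₃ onto ⇒
`E(K_∞)[3] = 0`), `H_𝔮 := H¹(K_𝔮, 𝕋)` (rank 2) for `𝔮 ∈ {𝔭, 𝔭′}`, `F := Ch_Λ(X_(∅,0))` the crux's ideal (relaxed at the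
crux's relaxed prime `𝔮_rel`, strict at the other), `L := L_𝔭^{BDP}` any integral BDP frame.
(PT) Poitou–Tate for the nested structures (strict ⊂ relaxed at `𝔮_rel`) gives the EXACT sequence
  `0 → H¹_(0 at 𝔮_rel)(K,𝕋) → M → H_{𝔮_rel} → X_(∅,0) → X_(0,0) → 0`,
and on Λ-torsion rows the first term is `0` (it is torsion inside the torsion-free `M`), whence the FACTORISATION
  `F = S · I`,  `S := Ch_Λ(X_(0,0))` (STRICT CORE: strict at both primes over 3 — `c`-symmetric, `S = S^ι`, independent of
  every local question at 3; `= char H²(G_{K,S},𝕋)` up to local `H²` terms), `I := Ch_Λ(H_{𝔮_rel} / loc M)` (LOCAL INDEX).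
(ε) Kato's local ε-isomorphism for the rank-two Λ-family `𝕋|_{G_{ℚ₃}}` — which EXISTS canonically for the non-trianguline
`V₃E|_{G_{ℚ₃}}` of an O6 curve [Nakamura, Camb. J. Math. 5 (2017) Thm 1.1/3.1: all rank ≤ 2 families, base-change compatible]
; its de Rham interpolation at ALL classical twists is Nakamura (ii) + Rodrigues Jacinto, Math. Ann. 372 (2018) Thm 3 — identifies
`I·Λ^{ur}` with `(ε(loc m₁ ∧ loc m₂))` for ANY Λ-basis `(m₁,m₂)` of `M**`, and turns `L` into Sano's
UNCONDITIONALLY DEFINED rank-two zeta element `z_{K_∞} := L · ε⁻¹ ∈ Q(Λ^{ur}) ⊗ ⋀²_Λ M` [Sano, arXiv:2510.01601 (2025) §1.4.2,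
§3; for `p ∤ N`: IMC ⟺ `char(⋂² M / Λ z_{K_∞}) = char H²(G_{K,S},𝕋)`].
(DOOR) RATWALL `F ∣ 3ᵏ L` ⟺ (Z-int) `I ∣ 3ᵇ L` — INTEGRALITY of `z_{K_∞}` up to a 3-power — ∧ (Z-core) `∀ q, I·q = 3ᵇ L →
S ∣ 3ᵃ q` — the integral zeta element is DIVISIBLE BY THE STRICT CORE.  Both conjuncts are WEAKER than the crux
(`pieces_of_crux_row`, kernel), jointly they give it (`split_door`, kernel), and the seam `F·R₀′⟦T⟧ ∋ S·I` is THEOREM-grade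
algebra (PT).  What the split buys: (Z-core) is generically VACUOUS (X_(0,0) pseudo-null on 3-primitive non-anomalous rows:
`Sel_str(K,E[3^∞]) = 0` ⇒ `X_(0,0) = 0` by Nakayama; in general `S ∣ gcd(F, F^ι)`, so chiral rows have `S = 3^μ`) and is a
FINE-SELMER statement (Coates–Sujatha territory, no analytic input at 3); (Z-int) is the ONE place analytic input is needed
and it is now a statement about an explicit element of `⋀² M` — the form in which Kataoka–Sano / Burns–Sakamoto–Sano
conjecture it (the `K_∞`-component of the motivic rank-2 Euler system of `h¹(E/K)(1)`), with no Heegner trace, no `U₃`,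
no family through `f`, and meaningful at NON-classical points (the object `M` specialises everywhere).
Why novel (problem-relative): none of 24207's 19 cards nor 20395's 26 splits the BDP characteristic ideal into strict core ×
local index or targets INTEGRALITY of a canonically defined element; g5/F4, wedge-square-host, nakayama-anchor, epsilon-supply,
fern-reciprocity all seek a SUPPLY (a class from geometry or a family) or use ε as a functional on a supplied class; here
there is no supply: `z_{K_∞}` is already defined (Sano 2025, not cited anywhere in the lineage) and the crux becomes
«denominator-freeness + core-divisibility».  Honest status: (Z-int) inherits the Λ-adic wall in the form «no motivic
construction of `z_{K_∞}` at additive 3» (B-g5-8 Kataoka–Sano formal+ordinary) — IDEA-NEEDED.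

## Pieces (selector-parametrised, as g17; intended selector `𝓢♮ := (S, I)` above; costume selector `𝓢₀ := (1, L)`)
P0 `SplitMemAtThree 𝓢`  : `∃ c, 3ᶜ·(S·I) ∈ F·R₀′⟦T⟧`.  [𝓢♮: ATTACKABLE theorem (PT, c = 0) — leaf L0 · 𝓢₀: COSTUME = crux
   (`splitMem_costume_iff`, kernel)]
P1 `IndexDvdAtThree 𝓢`  : `∃ b, I ∣ 3ᵇ·L`  (Z-int).  [𝓢♮: WEAKER (kernel `pieces_of_crux_row`); IDEA-NEEDED — leaf L1 ·
   𝓢₀: trivial (`indexDvd_costume`)]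
P2 `CoreDvdAtThree 𝓢`   : `∀ b q, 3ᵇ·L = I·q → ∃ a, S ∣ 3ᵃ·q`  (Z-core).  [𝓢♮: WEAKER (kernel); generically VACUOUS;
   INSTRUMENTABLE I-g18-1; IDEA-NEEDED on anomalous rows — leaf L2 · 𝓢₀: trivial (`coreDvd_costume`)]
KERNEL `rationalSplitIMCInclusionAtThree_of_coreSplit : ∀ 𝓢, P0 𝓢 → P1 𝓢 → P2 𝓢 → RationalSplitIMCInclusionAtThree`.
Node kind: IMPLIED-BY, jointly EQUIV for 𝓢♮ (P0 theorem ∧ (P1 ∧ P2 ⟺ crux)); the EQUIV has its child: {P1, P2}.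
`S`, `I`, `M`, `⋀²`, ε are not tree objects (D-g17-1), hence the selector; the semantics live here and in the card.

## Leaves
L0 (P0♮, ATTACKABLE, print-adjacent): Λ-adic Poitou–Tate for Selmer structures `(0 ⊂ ∅ at 𝔮_rel)` on `𝕋` + multiplicativity
   of `Ch` + `H¹_(0 at 𝔮_rel)(K,𝕋) = 0` on torsion rows [MR04 Thm 2.3.4 at finite level + lim; Sano 2510.01601 §1.5 PT
   sequence; tree: `PoitouTateSelmerStructureDualityFact` (item 20461 ✓) is the finite-coefficient shape]. Typing needs
   `H¹(G_{K,S},𝕋)` / a strict-at-both `XAc` (D-g18-1).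
L1 (P1♮ = Z-int, IDEA-NEEDED): `z_{K_∞} ∈ 3⁻ᵇ ⋂²_Λ M`.  Equivalent forms: (i) `I ∣ 3ᵇ L`; (ii) for every height-one
   `P ≠ (3)` at which `loc_{𝔮_rel} : M → H` drops rank — i.e. some Λ-adic global class becomes locally trivial at `𝔮_rel`
   at the (generically NON-classical) character `ψ_P` — `L` vanishes at `P` to at least that order.  Sub-leaves: L1a the
   motivic rank-2 system ([ks] Conj.; Kataoka–Sano JAMR 2 (2024); B-g5-8: their Heegner construction is formal + ordinary)
   — BARRIER at additive 3 as things stand; L1b TWO-VARIABLE descent: (Z-int)₂ for `Λ₂` restricts to (Z-int) (integrality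
   restricts along `Λ₂ → Λ`; top-degree base change `H²(𝕋₂) ⊗ Λ = H²(𝕋_ac)`), and on each 𝔭-axis tooth (Z-int) is implied
   by the LEAD's K2-rat — so L1b is NOT a new line, it is a WEAKER target the comb already covers (recorded, not claimed);
   L1c classical-point consistency (ATTACKABLE, small): at rim `χ` (finite order, `L′(f,χ,1) ≠ 0`): `I(χ) = 0 ⟺ L(χ) = 0`
   (isotropy of `H¹_f(K_𝔮)` + `Sel(K,V_χ) = ⟨y_χ⟩` + p-adic Waldspurger `L(χ) = log_𝔭(y_χ)²·unit`, LZZ); at interior `χ_j`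
   (`j ≥ 1`; relaxed/strict = Bloch–Kato there) `I(χ_j)` is a rank-2 dual-exponential determinant, meaningful by Nakamura +
   Rodrigues Jacinto 2018 (B-g18-6 withdrawn) — a CHECK of the dictionary, blind to generic roots (B-g14-1), no progress by itself.
L2 (P2♮ = Z-core, INSTRUMENTABLE / IDEA-NEEDED): `S(0)·unit = #Sel_str(K,E[3^∞])·(control)`, and on 3-primitive rows
   `#Sel_str(K) = 3^{d}` with `d = ` the 3-divisibility of `y_K` in `E(K_𝔭) ⊗ ℤ₃` (Honda `Ê ≅ Ĝ_a`: `d ≈ v₃(log_ω y_K) − 1`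
   up to `[E(ℚ₃):E₁(ℚ₃)] ∣ 3c₃`).  I-g18-1: census of anomalous O6 rows (`d ≥ 1` or `Ш(E/K)[3] ≠ 0`); on all other rows
   P2♮ is vacuous and RATWALL = (Z-int) on the nose.  Tools when non-vacuous: `S = S^ι ∣ gcd(F,F^ι)`; fine-Selmer control
   (Coates–Sujatha 2005; Wuthrich); Cassels–Tate/Flach self-duality of `X_(0,0)`.

## Barrier notes g18 (harvestable; one line each, evidence in the seat's NOTES.md)
B-g18-1 ULTRAPRODUCT PATCHING of layer-`m` Kolyvagin systems (g17 brief (c)) is dead: projections `m → m′` carry `Tr D_m =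
  3^{m−m′} D_{m′}` (or `3^{(m−m′)/2}` after removing the forced half-order), so every patched limit has `κ₁ = 0`.
B-g18-2 RESOLVENT HALF-DIFFERENT: for ANY integral local point at layer `m`, `v₃` of a `χ`-resolvent of its logarithm is
  `≳ d_m/(2·3^m) ≈ m/2` (`d_m = ((2m+1)3^m − 1)/2`), so the «half-order divisibility» of Heegner logs is ramification-forced on
  all points and per-layer Kolyvagin slack is μ-scale (`c′φ(3^m)`): rim methods bound `μ`, never `λ` (refines B-g12-1/B-g16-1).
B-g18-3 DOUBLY-ADMISSIBLE PRIMES: at `p = 3` every inert Kolyvagin prime has `a_ℓ ≡ ℓ+1 ≡ −(ℓ+1) ≡ 0`, and level-raising at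
  the two maximal ideals `𝔪^± = (𝔪, U_ℓ ∓ 1)` separately is clean (`2 ∈ ℤ₃ˣ`), so `NoAdmissiblePrimesAtThree` is a statement
  about BD's definition; the BDP-direction bipartite system dies anyway because odd levels need Λ-adic classes on DEFINITE
  Shimura sets (sign −1 in the BDP range — no geometry), and layerwise bipartite = rim Kolyvagin (B-g18-2).
B-g18-4 BOREL-QUARTIC EISENSTEIN DESCENT: ρ̄₃ onto ⇒ over the degree-4 field `M₀ = ℚ(E[3])^{Borel}` (index prime to 3, exact
  res/cores descent) `E[3]` is reducible, but CGLS-type Eisenstein congruences give mod-3 `(λ, μ)` information only (depth 1;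
  `E[9]`-Borel has index 12) — no root location; and «Eisenstein rational inclusion ∧ λ(Ch) ≤ λ(L)» IS g0's door verbatim.
B-g18-5 FROBENIUS ON `R₀′`: `F ∈ ℤ₃⟦T⟧` has Frobenius-stable roots while `L ∈ R₀′⟦T⟧`; but `(L^φ) = (L)·unit` is forced by
  Shimura reciprocity (`A ↦ 𝔭⁻¹ ∗ A` shifts `T` by a unit), so rationality of `L`'s root multiset is a CHECK (Q-g18-1), not a lever.
B-g18-6 (WITHDRAWN by this seat the same session — recorded so nobody re-derives the false version): Nakamura 2017 Thm 1.1 proves the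
  de Rham compatibility of his rank-2 ε-isomorphism only for (i) trianguline or (ii) HT weights `{k₁ ≤ 0, k₂ ≥ 1}`, which misses the
  interior BDP points (`{j, j+1}`, `j ≥ 1`) of the NON-trianguline `V₃E|_{G_{ℚ₃}}`; but Rodrigues Jacinto, Math. Ann. 372 (2018) Thm 3
  [corpus:paper:arxiv-1702.05637 p7 L27–28, p15 L7] proves the complementary range (`j ≥ 1`, via Colmez's p-adic local Langlands and
  changement de poids) and hence «la conjecture ε locale de Kato est vraie pour les représentations galoisiennes de dimension 2».  So the
  de Rham meaning of `ε_Λ` IS available at every classical point of the anticyclotomic line (rim and interior); Q-g18-2 is ANSWERED (yes —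
  by RJ 2018, not by Nakamura's 2023 sequel, which is `p ≥ 5` and about zeta morphisms [corpus:paper:arxiv-2006.13647 p4 L12–14]).  NOT a
  barrier.  Consequence for this node: leaf L1c (classical-point dictionary `I(χ) = 0 ⟺ L(χ) = 0`) extends from the rim to the interior
  points `χ_j` (where the crux's relaxed/strict conditions ARE the Bloch–Kato conditions and `I(χ_j)` is a rank-2 dual-exponential
  determinant), still pointwise-blind to generic roots (B-g14-1); and Sano's IMC ⇒ TNC descent (2510.01601 Thm 2.7 shape) has its LOCAL
  ingredient at 3 for O6 curves — the global explicit reciprocity at additive 3 is the route's own `IsBDPLFunction` content.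

Disproof used: none on file for 24207 (`ledger crux ls`: no Disproof.lean; negatives 15532, 24881 unrelated).  Honours the
recorded kills: K1-DECISION (tempered order 1), B-g5-1..10, B-g14-1, B-g16-1..4, B-g17-1..4 — the node uses no Heegner trace,
no `U₃`, no family through `f`, no admissible prime, no layer functional.

Refs: Sano arXiv:2510.01601 (2025) §1.4.2 eq. for IMC ⟺ `char(⋂²H¹/Λz) = char H²`, §1.5 PT, §3.1 local epsilon element
[corpus:paper:arxiv-2510.01601 p4 L21–25, p5 L3–5, p8 L3–5]; Nakamura, Camb. J. Math. 5 (2017) 281–368, Thm 1.1 (p3–4), Thm 1.3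
(p6: functional equation of Kato's ES for `f` supercuspidal at p) [corpus:paper:doi-10-4310-cjm-2017-v5-n3-a1]; Rodrigues Jacinto,
Math. Ann. 372 (2018) 1277–1334, Thm 1 / Thm 3 (local ε-conjecture in dimension 2) [corpus:paper:arxiv-1702.05637 p5, p7]; Nakamura,
Invent. Math. 234 (2023) 171–290 = arXiv:2006.13647 (zeta morphisms, `p ≥ 5`; does not concern the ε range); Kataoka–Sano,
J. Assoc. Math. Res. 2 (2024) 154–208; Sano arXiv:2308.08875; Burns–Sakamoto–Sano III arXiv:1902.07002; Agboola–Castella JTNB 33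
(2021); Mazur–Rubin, Mem. AMS 799 (2004) Thm 2.3.4; Coates–Sujatha, Math. Ann. 331 (2005); Castella, Camb. J. Math. 6 (2018)
§2 (the tree's `XAc`); KingsLoefflerZerbes2017, LeiLoefflerZerbes2015, arXiv:2003.13738, GreenbergVatsal2000 (crux sources).
-/

set_option autoImplicit false
set_option linter.dupNamespace false

noncomputable section

open scoped Classical

namespace Summit.BirchSwinnertonDyer.BirchSwinnertonDyer.Cruxes.RationalSplitIMCInclusionAtThree.ZetaIntegralityCoreSplit

/-! ## §A  Door algebra (any commutative ring) and the WEAKER certificate (any domain). -/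

/-- **Core-splitting door.** If `t ^ c * (S * I) ∈ J` (the seam: `J ⊇ 3ᶜ·(strict core · local index)`), `I ∣ t ^ b * L`
(zeta integrality) and the cofactor is divisible by the core (`t ^ b * L = I * q → S ∣ t ^ a * q`), then `t ^ k * L ∈ J`. -/
theorem split_door {R : Type*} [CommRing R] {J : Ideal R} {t S I L : R} {c : ℕ}
    (hmem : t ^ c * (S * I) ∈ J) (hI : ∃ b : ℕ, I ∣ t ^ b * L)
    (hS : ∀ (b : ℕ) (q : R), t ^ b * L = I * q → ∃ a : ℕ, S ∣ t ^ a * q) :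
    ∃ k : ℕ, t ^ k * L ∈ J := by
  obtain ⟨b, q, hq⟩ := hI
  obtain ⟨a, r, hr⟩ := hS b q hq
  refine ⟨c + (a + b), ?_⟩
  have e : t ^ (c + (a + b)) * L = r * (t ^ c * (S * I)) := by
    calc t ^ (c + (a + b)) * L = t ^ c * (t ^ a * (t ^ b * L)) := by rw [pow_add, pow_add]; ring
      _ = t ^ c * (t ^ a * (I * q)) := by rw [hq]
      _ = t ^ c * (I * (t ^ a * q)) := by ring
      _ = t ^ c * (I * (S * r)) := by rw [hr]
      _ = r * (t ^ c * (S * I)) := by ring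
  rw [e]
  exact J.mul_mem_left _ hmem

/-- **WEAKER certificate.** On a row where the crux's ideal IS `(S * I)` with `I ≠ 0` (the intended selector: Poitou–Tate
factorisation, `Λ`-torsion row), the crux `∃ k, t ^ k * L ∈ J` implies BOTH pieces: zeta integrality `I ∣ t ^ b * L` and
core divisibility of the cofactor.  So neither piece is stronger than the crux. -/
theorem pieces_of_crux_row {R : Type*} [CommRing R] [IsDomain R] {J : Ideal R} {t S I L : R}
    (hJ : J = Ideal.span {S * I}) (hI0 : I ≠ 0) (h : ∃ k : ℕ, t ^ k * L ∈ J) :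
    (∃ b : ℕ, I ∣ t ^ b * L) ∧ (∀ (b : ℕ) (q : R), t ^ b * L = I * q → ∃ a : ℕ, S ∣ t ^ a * q) := by
  obtain ⟨k, hk⟩ := h
  rw [hJ, Ideal.mem_span_singleton] at hk
  refine ⟨⟨k, dvd_trans (dvd_mul_left I S) hk⟩, fun b q hq => ⟨k, ?_⟩⟩
  have e1 : t ^ k * (I * q) = t ^ b * (t ^ k * L) := by rw [← hq]; ring
  have h1 : S * I ∣ t ^ k * (I * q) := by rw [e1]; exact dvd_mul_of_dvd_right hk _
  have h2 : I * S ∣ I * (t ^ k * q) := by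
    have e2 : I * (t ^ k * q) = t ^ k * (I * q) := by ring
    rw [e2, mul_comm I S]; exact h1
  exact (mul_dvd_mul_iff_left hI0).mp h2

/-- **Strict core divides the symmetric part.** If `F = S * I` and `F' = S * I'` (the factorisations at the two primes over
3, `F' = F^ι`, `S = S^ι`), then `S` divides every `Λ`-combination `x * F + y * F'` — in a gcd domain, `S ∣ gcd(F, F^ι)`:
on «chiral» rows (`F`, `F^ι` coprime up to 3-powers) the core is a 3-power and the crux IS zeta integrality. -/
theorem core_dvd_combination {R : Type*} [CommRing R] {F F' S I I' x y : R} (hF : F = S * I) (hF' : F' = S * I') :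
    S ∣ x * F + y * F' :=
  ⟨x * I + y * I', by rw [hF, hF']; ring⟩

/-! ## §B  The pieces, under 24207's binders (verbatim prefix of the crux).

`ext := PowerSeries.map (toUnr 3) : Λ = ℤ₃⟦T⟧ → R₀′⟦T⟧ = UnrSeries 3`, `J := (Ch_Λ X_(∅,0)).map ext` (the crux's ideal). -/

/-- **(SD) SPLITTING DATUM** — the type of a selector assigning to the row data `(W, K, κ, γ, 𝔭, 𝔭′, L)` a pair
`(S, I) ∈ R₀′⟦T⟧²` (informally: INTENDED `𝓢♮ = (Ch_Λ X_(0,0), Ch_Λ(H¹(K_{𝔮_rel},𝕋)/loc H¹(G_{K,S},𝕋)))·R₀′⟦T⟧` = (strict core,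
local ε-index); COSTUME `𝓢₀ = (1, L)`; formally ANY selector — the door is sound for all of them). -/
def SplittingDatum : Type 1 :=
  ∀ (W : WeierstrassCurve ℚ) (K : Type) [Field K] [NumberField K],
    Literature.NumberTheory.EllipticCurves.ZpExtension K 3 → Field.absoluteGaloisGroup K →
      IsDedekindDomain.HeightOneSpectrum (NumberField.RingOfIntegers K) →
        IsDedekindDomain.HeightOneSpectrum (NumberField.RingOfIntegers K) →
          Literature.NumberTheory.EllipticCurves.UnrSeries 3 →
            Literature.NumberTheory.EllipticCurves.UnrSeries 3 × Literature.NumberTheory.EllipticCurves.UnrSeries 3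

/-- **(P0) SEAM** [𝓢♮: ATTACKABLE theorem-grade (Λ-adic Poitou–Tate, `c = 0`; leaf L0) · 𝓢₀: COSTUME = the crux
(`splitMem_costume_iff`)]: on every row of the crux, `∃ c, 3ᶜ·(S·I) ∈ Ch_Λ(X_(∅,0))·R₀′⟦T⟧`. -/
def SplitMemAtThree (𝓢 : SplittingDatum) : Prop :=
  ∀ (W : WeierstrassCurve ℚ) [W.IsElliptic] [W.IsGloballyMinimal] (N : ℕ) [NeZero N] (K : Type) [Field K] [NumberField K] (Dt : Literature.NumberTheory.EllipticCurves.ModularForms.ModularParametrizationData W N), Summit.BirchSwinnertonDyer.Rank1Residual.Additive.ClassO6 W 3 → W.HasSurjectiveModNGaloisRep 3 → W.analyticRank = 1 → W.conductorNorm ℤ = N → Literature.NumberTheory.EllipticCurves.IsImaginaryQuadratic K → Literature.NumberTheory.EllipticCurves.SatisfiesHeegnerHypothesis N K → ∀ (κ : Literature.NumberTheory.EllipticCurves.ZpExtension K 3), κ.IsAnticyclotomic → ∀ (γ : Field.absoluteGaloisGroup K) [Fact (κ.IsTopGenerator γ)] (𝔭 : IsDedekindDomain.HeightOneSpectrum (NumberField.RingOfIntegers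 K)), ((3 : ℕ) : NumberField.RingOfIntegers K) ∈ 𝔭.asIdeal → 𝔭.asIdeal.ramificationIdx (NumberField.RingOfIntegers ℚ) = 1 → 𝔭.asIdeal.inertiaDeg (NumberField.RingOfIntegers ℚ) = 1 → ∀ (𝔭' : IsDedekindDomain.HeightOneSpectrum (NumberField.RingOfIntegers K)), ((3 : ℕ) : NumberField.RingOfIntegers K) ∈ 𝔭'.asIdeal → 𝔭' ≠ 𝔭 → ∀ (ι' : PadicAlgCl 3 ≃+* ℂ), Summit.BirchSwinnertonDyer.BirchSwinnertonDyer.Theorems.SchneiderFree.BranchInducesPrime 3 ι' 𝔭 → ∀ (ΩK : ℂ) (Ωp : ℂ_[3]) (L : Literature.NumberTheory.EllipticCurves.UnrSeries 3), ΩK ≠ 0 → Ωp ≠ 0 → Literature.NumberTheory.EllipticCurves.IsBDPLFunction ι' 𝔭 κ γ Dt.f ΩK Ωp L →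
    ∃ c : ℕ, ((3 : ℕ) : Literature.NumberTheory.EllipticCurves.UnrSeries 3) ^ c *
        ((𝓢 W K κ γ 𝔭 𝔭' L).1 * (𝓢 W K κ γ 𝔭 𝔭' L).2) ∈
      (Summit.BirchSwinnertonDyer.Rank1Residual.X11b.AcSelmer.XAc.charIdeal (W.baseChange K) 3 κ 𝔭' ∅ γ).map
        (PowerSeries.map (Summit.BirchSwinnertonDyer.Rank1Residual.X11b.Halves.toUnr 3))

/-- **(P1) ZETA INTEGRALITY (Z-int)** [𝓢♮: WEAKER than the crux (`pieces_of_crux_row`); IDEA-NEEDED (leaf L1: no motivic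
construction of Sano's `z_{K_∞}` at additive 3; meaningful at non-classical points) · 𝓢₀: trivially true (`indexDvd_costume`)]:
on every row, `∃ b, I ∣ 3ᵇ·L` — the local ε-index of the global lattice divides the BDP function. -/
def IndexDvdAtThree (𝓢 : SplittingDatum) : Prop :=
  ∀ (W : WeierstrassCurve ℚ) [W.IsElliptic] [W.IsGloballyMinimal] (N : ℕ) [NeZero N] (K : Type) [Field K] [NumberField K] (Dt : Literature.NumberTheory.EllipticCurves.ModularForms.ModularParametrizationData W N), Summit.BirchSwinnertonDyer.Rank1Residual.Additive.ClassO6 W 3 → W.HasSurjectiveModNGaloisRep 3 → W.analyticRank = 1 → W.conductorNorm ℤ = N → Literature.NumberTheory.EllipticCurves.IsImaginaryQuadratic K → Literature.NumberTheory.EllipticCurves.SatisfiesHeegnerHypothesis N K → ∀ (κ : Literature.NumberTheory.EllipticCurves.ZpExtension K 3), κ.IsAnticyclotomic → ∀ (γ : Field.absoluteGaloisGroup K) [Fact (κ.IsTopGenerator γ)] (𝔭 : IsDedekindDomain.HeightOneSpectrum (NumberField.RingOfIntegers K)), ((3 : ℕ) : NumberField.RingOfIntegers K) ∈ 𝔭.asIdeal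 → 𝔭.asIdeal.ramificationIdx (NumberField.RingOfIntegers ℚ) = 1 → 𝔭.asIdeal.inertiaDeg (NumberField.RingOfIntegers ℚ) = 1 → ∀ (𝔭' : IsDedekindDomain.HeightOneSpectrum (NumberField.RingOfIntegers K)), ((3 : ℕ) : NumberField.RingOfIntegers K) ∈ 𝔭'.asIdeal → 𝔭' ≠ 𝔭 → ∀ (ι' : PadicAlgCl 3 ≃+* ℂ), Summit.BirchSwinnertonDyer.BirchSwinnertonDyer.Theorems.SchneiderFree.BranchInducesPrime 3 ι' 𝔭 → ∀ (ΩK : ℂ) (Ωp : ℂ_[3]) (L : Literature.NumberTheory.EllipticCurves.UnrSeries 3), ΩK ≠ 0 → Ωp ≠ 0 → Literature.NumberTheory.EllipticCurves.IsBDPLFunction ι' 𝔭 κ γ Dt.f ΩK Ωp L →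
    ∃ b : ℕ, (𝓢 W K κ γ 𝔭 𝔭' L).2 ∣ ((3 : ℕ) : Literature.NumberTheory.EllipticCurves.UnrSeries 3) ^ b * L

/-- **(P2) CORE DIVISIBILITY (Z-core)** [𝓢♮: WEAKER than the crux (`pieces_of_crux_row`); generically VACUOUS (`X_(0,0)`
pseudo-null: 3-primitive non-anomalous rows); INSTRUMENTABLE I-g18-1; IDEA-NEEDED on anomalous rows (leaf L2) · 𝓢₀: trivially
true (`coreDvd_costume`)]: on every row, whenever `3ᵇ·L = I·q`, the strict core divides the cofactor: `∃ a, S ∣ 3ᵃ·q`. -/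
def CoreDvdAtThree (𝓢 : SplittingDatum) : Prop :=
  ∀ (W : WeierstrassCurve ℚ) [W.IsElliptic] [W.IsGloballyMinimal] (N : ℕ) [NeZero N] (K : Type) [Field K] [NumberField K] (Dt : Literature.NumberTheory.EllipticCurves.ModularForms.ModularParametrizationData W N), Summit.BirchSwinnertonDyer.Rank1Residual.Additive.ClassO6 W 3 → W.HasSurjectiveModNGaloisRep 3 → W.analyticRank = 1 → W.conductorNorm ℤ = N → Literature.NumberTheory.EllipticCurves.IsImaginaryQuadratic K → Literature.NumberTheory.EllipticCurves.SatisfiesHeegnerHypothesis N K → ∀ (κ : Literature.NumberTheory.EllipticCurves.ZpExtension K 3), κ.IsAnticyclotomic → ∀ (γ : Field.absoluteGaloisGroup K) [Fact (κ.IsTopGenerator γ)] (𝔭 : IsDedekindDomain.HeightOneSpectrum (NumberField.RingOfIntegers K)), ((3 : ℕ) : NumberField.RingOfIntegers K) ∈ 𝔭.asIdeal → 𝔭.asIdeal.ramificationIdx (NumberField.RingOfIntegers ℚ) = 1 → 𝔭.asIdeal.inertiaDeg (NumberField.RingOfIntegers ℚ) = 1 → ∀ (𝔭' : IsDedekindDomain.HeightOneSpectrum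 (NumberField.RingOfIntegers K)), ((3 : ℕ) : NumberField.RingOfIntegers K) ∈ 𝔭'.asIdeal → 𝔭' ≠ 𝔭 → ∀ (ι' : PadicAlgCl 3 ≃+* ℂ), Summit.BirchSwinnertonDyer.BirchSwinnertonDyer.Theorems.SchneiderFree.BranchInducesPrime 3 ι' 𝔭 → ∀ (ΩK : ℂ) (Ωp : ℂ_[3]) (L : Literature.NumberTheory.EllipticCurves.UnrSeries 3), ΩK ≠ 0 → Ωp ≠ 0 → Literature.NumberTheory.EllipticCurves.IsBDPLFunction ι' 𝔭 κ γ Dt.f ΩK Ωp L →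
    ∀ (b : ℕ) (q : Literature.NumberTheory.EllipticCurves.UnrSeries 3),
      ((3 : ℕ) : Literature.NumberTheory.EllipticCurves.UnrSeries 3) ^ b * L = (𝓢 W K κ γ 𝔭 𝔭' L).2 * q →
        ∃ a : ℕ, (𝓢 W K κ γ 𝔭 𝔭' L).1 ∣ ((3 : ℕ) : Literature.NumberTheory.EllipticCurves.UnrSeries 3) ^ a * q

/-- The COSTUME selector `𝓢₀ = (1, L)`: no core, the «index» is `L` itself. -/
def costumeDatum : SplittingDatum := fun _ _ _ _ _ _ _ _ L => (1, L)

/-- COSTUME certificate 1/3: with `𝓢₀`, the seam P0 IS the crux (recorded so nobody mistakes P0 for progress by itself). -/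
theorem splitMem_costume_iff :
    SplitMemAtThree costumeDatum ↔
      Summit.BirchSwinnertonDyer.BirchSwinnertonDyer.Theses.UniversalToricDescent.RationalSplitIMCInclusionAtThree := by
  unfold SplitMemAtThree costumeDatum
    Summit.BirchSwinnertonDyer.BirchSwinnertonDyer.Theses.UniversalToricDescent.RationalSplitIMCInclusionAtThree
  simp only [one_mul]

/-- COSTUME certificate 2/3: with `𝓢₀`, zeta integrality is trivially true (`L ∣ 3⁰·L`). -/
theorem indexDvd_costume : IndexDvdAtThree costumeDatum := by
  intro W _ _ N _ K _ _ Dt _ _ _ _ _ _ κ _ γ _ 𝔭 _ _ _ 𝔭' _ _ ι' _ ΩK Ωp L _ _ _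
  exact ⟨0, by simp [costumeDatum]⟩

/-- COSTUME certificate 3/3: with `𝓢₀`, core divisibility is trivially true (`1 ∣ _`). -/
theorem coreDvd_costume : CoreDvdAtThree costumeDatum := by
  intro W _ _ N _ K _ _ Dt _ _ _ _ _ _ κ _ γ _ 𝔭 _ _ _ 𝔭' _ _ ι' _ ΩK Ωp L _ _ _ b q _
  exact ⟨0, by simp [costumeDatum]⟩

/-! ## §C  Kernel theorem: the door concludes the crux BY NAME. -/

/-- **KERNEL (no sorry).** Seam + zeta integrality + core divisibility imply crux 24207, for ANY splitting datum. -/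
theorem rationalSplitIMCInclusionAtThree_of_coreSplit (𝓢 : SplittingDatum)
    (h0 : SplitMemAtThree 𝓢) (h1 : IndexDvdAtThree 𝓢) (h2 : CoreDvdAtThree 𝓢) :
    Summit.BirchSwinnertonDyer.BirchSwinnertonDyer.Theses.UniversalToricDescent.RationalSplitIMCInclusionAtThree := by
  intro W _ _ N _ K _ _ Dt hO6 hsurj hr1 hN hK hH κ hκ γ _ 𝔭 h𝔭 he hf 𝔭' h𝔭' hne ι' hι ΩK Ωp L hΩK hΩp hL
  obtain ⟨c, hc⟩ := h0 W N K Dt hO6 hsurj hr1 hN hK hH κ hκ γ 𝔭 h𝔭 he hf 𝔭' h𝔭' hne ι' hι ΩK Ωp L hΩK hΩp hL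
  have hI := h1 W N K Dt hO6 hsurj hr1 hN hK hH κ hκ γ 𝔭 h𝔭 he hf 𝔭' h𝔭' hne ι' hι ΩK Ωp L hΩK hΩp hL
  have hS := h2 W N K Dt hO6 hsurj hr1 hN hK hH κ hκ γ 𝔭 h𝔭 he hf 𝔭' h𝔭' hne ι' hι ΩK Ωp L hΩK hΩp hL
  exact split_door hc hI hS

end Summit.BirchSwinnertonDyer.BirchSwinnertonDyer.Cruxes.RationalSplitIMCInclusionAtThree.ZetaIntegralityCoreSplit

end
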